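import Summits.QuantumFields.YangMills.Theorems.AlphaInputsT3ACv3LinearLiftSpread
import Summits.QuantumFields.YangMills.Theorems.AlphaInputsT3ACv3LinearLiftProfileLipIds
import HarnessLib

/-!
# `AlphaInputsT3ACv3LinearLiftTorus1DLip` — (LL) STEP L2a-Lip: THE LIPSCHITZ PROFILES ON THE DISCRETE CIRCLE `ℤ/(n·N_k)` — exact cell sums, partition of unity, chain identity,
# exact segment means, the `ℓ¹`-in-the-cell bounds AND THE LIPSCHITZ ROWS — cell `ym3-torus`, width seat `ym3-torus-px19` (g3), line «SYM-CENTRE» row (R3)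

By-name twin of `AlphaInputsT3ACv3LinearLiftTorus1D` §2–§3 + `…Torus1DSeg` §4 (seat `ym-ust-19936-w2` g0) for the Lipschitz profiles `σ_L`, `τ_L` of `…ProfileLip{,Ids}`: the
indicator periodisations `PσL(a, c) = PS σ_L q(a) t(a) c`, `PτL(a, c) = PS τ_L q(a) t(a) c` (the cell index `qIdx`, the centred offset `tOff`, the periodisation `PS`, `cellFin`
and every profile-free lemma are REUSED BY NAME from the landed files), and
* §2 `PsigL_cell` (Σ over a cell `= n·[c = c′]`), `PsigL_pou` (Σ over cells `= 1`); §3 `PsigL_add_one`, `PtauL_add_nat`, `PtauL_pred`, the CHAIN IDENTITY `PsigL_add_one_sub`;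
  §4 `PtauL_seg` (exact segment means) — proofs verbatim with `σ, τ ↦ σ_L, τ_L`;
* §5 (NEW) `PtauL_add_one` (the 1-form profile one step on, incl. the cell-crossing case), the `ℓ¹`-in-the-cell bounds `sum_abs_PsigL_le` (`≤ 54`), `sum_abs_PtauL_le`
  (`≤ 54/n`) and ★ THE LIPSCHITZ ROWS `sum_abs_PsigL_add_one_sub_le` (`Σ_c |PσL(a+1,c) − PσL(a,c)| ≤ 108/n`), ★★ `sum_abs_PtauL_add_one_sub_le`
  (`Σ_c |PτL(a+1,c) − PτL(a,c)| ≤ 330/n²`) — the inputs of the Lipschitz bound of the tensor spreading `S²_L` (sibling `…SpreadLip`).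
HONEST FRAMING.  Elementary bookkeeping on `ZMod`; nothing of [Balaban1987RG1]∕[Balaban1985UV3] asserted; count-neutral helper toward the symmetric-centre row of the EX display
(`--supports stmt-QuantumFields-19200`); registry untouched.  YM₃ on the torus is a RUNG of the programme, not the Clay problem; no claim about d = 4, infinite volume or a mass gap.

References: T. Bałaban, Commun. Math. Phys. 109 (1987) 249–301 [Balaban1987RG1] ((0.1) p.251: the tori `T^{(j)}`, `L^j` sites per block side; (0.4) p.253).
-/

set_option autoImplicit false

noncomputable section

namespace Summit.QuantumFields.YangMills.Theorems.LinearLiftProfileLip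

open Finset
open Summit.QuantumFields.YangMills.Theorems.LinearLiftProfile
open Summit.QuantumFields.YangMills.Theorems.LinearLiftSpread (sum_abs_PS_le)

variable (h : ℕ) {N₀ Nk : ℕ}

/-! ## §1 The indicator periodisations of the Lipschitz profiles -/

/-- **THE LIPSCHITZ 0-FORM PROFILE OF THE CELL `c` READ AT THE FINE COORDINATE `a`.** [folklore] -/
def PsigL (a : ZMod N₀) (c : ZMod Nk) : ℝ := PS h (sigmaL h) (qIdx h a) (tOff h a) c

/-- **THE LIPSCHITZ 1-FORM PROFILE OF THE CELL `c` READ AT THE FINE COORDINATE `a`.** [folklore] -/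
def PtauL (a : ZMod N₀) (c : ZMod Nk) : ℝ := PS h (tauL h) (qIdx h a) (tOff h a) c

/-! ## §2 Exact cell sums and the partition of unity on the circle -/

/-- **(i) ON THE CIRCLE — EXACT CELL SUMS**: `Σ_{a ∈ cell c′} Pσ(a, c) = n·[c = c′]`. [folklore] -/
theorem PsigL_cell [NeZero N₀] [NeZero Nk] (hN : N₀ = side h * Nk) (c c' : ZMod Nk) :
    ∑ a ∈ (cellFin h c' : Finset (ZMod N₀)), PsigL h a c = if c = c' then (side h : ℝ) else 0 := by
  -- inside the cell the indicator is constant: `q(a) = c′`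
  have e : ∀ a ∈ (cellFin h c' : Finset (ZMod N₀)), PsigL h a c = PS h (sigmaL h) (c'.val : ℤ) (tOff h a) c := by
    intro a ha; rw [mem_cellFin] at ha; unfold PsigL; rw [ha]
  rw [sum_congr rfl e]
  unfold PS
  rw [sum_comm]
  have e2 : ∀ r ∈ trip, ∑ a ∈ (cellFin h c' : Finset (ZMod N₀)), (if c = (((c'.val : ℤ) - r : ℤ) : ZMod Nk) then sigmaL h (tOff h a + r * side h) else 0)
      = if c = (((c'.val : ℤ) - r : ℤ) : ZMod Nk) then (if r = 0 then (side h : ℝ) else 0) else 0 := by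
    intro r _
    by_cases hc : c = (((c'.val : ℤ) - r : ℤ) : ZMod Nk)
    · simp only [if_pos hc]
      rw [sum_cellFin h hN (fun t => sigmaL h (t + r * side h)), cellSum_sigmaL]
    · simp only [if_neg hc]
      exact sum_const_zero
  rw [sum_congr rfl e2, sum_trip]
  have hc' : (((c'.val : ℤ) - 0 : ℤ) : ZMod Nk) = c' := by simp
  simp only [hc']
  by_cases hcc : c = c'
  · simp [hcc]
  · simp [hcc]

/-- **(ii) ON THE CIRCLE — PARTITION OF UNITY**: `Σ_c Pσ(a, c) = 1`. [folklore] -/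
theorem PsigL_pou [NeZero Nk] (a : ZMod N₀) : ∑ c : ZMod Nk, PsigL h a c = 1 := by
  unfold PsigL PS
  rw [sum_comm]
  simp_rw [sum_ite_eq']
  simp only [mem_univ, if_true]
  rw [sum_trip]
  have ht := tOff_mem h a
  have := pou_sigmaL h (tOff h a) ht
  rw [show tOff h a + -1 * (side h : ℤ) = tOff h a - side h by ring, show tOff h a + 0 * (side h : ℤ) = tOff h a by ring,
    show tOff h a + 1 * (side h : ℤ) = tOff h a + side h by ring]
  exact this

/-! ## §3 Shifts and the chain identity on the circle -/

/-- **THE 0-FORM PROFILE ONE STEP ON**: `Pσ(a + 1, c) = PS σ q(a) (t(a) + 1) c` (in the next-cell case the re-basing costs nothing: the two boundary values vanish). [folklore] -/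
theorem PsigL_add_one [NeZero N₀] (hN : N₀ = side h * Nk) (a : ZMod N₀) (c : ZMod Nk) : PsigL h (a + 1) c = PS h (sigmaL h) (qIdx h a) (tOff h a + 1) c := by
  have hn : (side h : ℤ) = 2 * h + 1 := side_int h
  have ht := tOff_mem h a
  have hp := two_prad_le h
  unfold PsigL
  by_cases hle : tOff h a + 1 ≤ h
  · obtain ⟨h1, h2⟩ := qIdx_tOff_add_of_le h hN a 1 (by push_cast; exact hle)
    push_cast at h1 h2
    rw [h1, h2]
  · have hlt : (h : ℤ) < tOff h a + (1 : ℕ) := by push_cast; omega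
    obtain ⟨h1, h2⟩ := qIdx_tOff_add_of_lt h hN a 1 (by have := side_pos h; omega) hlt
    push_cast at h1 h2
    -- `PS σ q' t' c` only depends on `q'` through its class mod `N_k`
    have h1' : (((qIdx h (a + 1) : ℕ) : ℤ) : ZMod Nk) = ((((qIdx h a : ℕ) : ℤ) + 1 : ℤ) : ZMod Nk) := by push_cast at h1 ⊢; exact h1
    rw [h2, PS_congr_mod h (sigmaL h) h1', PS_succ_sub_side]
    · exact sigmaL_eq_zero h (Or.inr (by omega))
    · exact sigmaL_eq_zero h (Or.inl (by omega))

/-- **THE 1-FORM PROFILE `m < n` STEPS ON**: `Pτ(a + m, c) = PS τ q(a) (t(a) + m) c`. [folklore] -/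
theorem PtauL_add_nat [NeZero N₀] (hN : N₀ = side h * Nk) (a : ZMod N₀) (c : ZMod Nk) (m : ℕ) (hm : m < side h) :
    PtauL h (a + (m : ZMod N₀)) c = PS h (tauL h) (qIdx h a) (tOff h a + m) c := by
  have hn : (side h : ℤ) = 2 * h + 1 := side_int h
  have ht := tOff_mem h a
  have hp := two_prad_le h
  unfold PtauL
  by_cases hle : tOff h a + m ≤ h
  · obtain ⟨h1, h2⟩ := qIdx_tOff_add_of_le h hN a m hle
    rw [h1, h2]
  · have hlt : (h : ℤ) < tOff h a + m := by omega
    obtain ⟨h1, h2⟩ := qIdx_tOff_add_of_lt h hN a m hm.le hlt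
    have h1' : (((qIdx h (a + (m : ZMod N₀)) : ℕ) : ℤ) : ZMod Nk) = ((((qIdx h a : ℕ) : ℤ) + 1 : ℤ) : ZMod Nk) := by push_cast at h1 ⊢; exact h1
    rw [h2, PS_congr_mod h (tauL h) h1', PS_succ_sub_side]
    · exact tauL_eq_zero h (Or.inr (by omega))
    · exact tauL_eq_zero h (Or.inl (by omega))

/-- `Pτ(a, c − 1) = PS τ q(a) (t(a) + n) c` (the previous cell's 1-form profile, re-based). [folklore] -/
theorem PtauL_pred (a : ZMod N₀) (c : ZMod Nk) : PtauL h a (c - 1) = PS h (tauL h) (qIdx h a) (tOff h a + side h) c := by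
  have hn : (side h : ℤ) = 2 * h + 1 := side_int h
  have ht := tOff_mem h a
  have hp := two_prad_le h
  unfold PtauL
  rw [← PS_succ_eq_pred, ← PS_succ_sub_side h (tauL h) (qIdx h a) (tOff h a + side h) c]
  · ring_nf
  · exact tauL_eq_zero h (Or.inr (by omega))
  · exact tauL_eq_zero h (Or.inl (by omega))

/-- **(iii) ON THE CIRCLE — THE CHAIN IDENTITY**: `Pσ(a+1, c) − Pσ(a, c) = Pτ(a, c−1) − Pτ(a, c)` (the discrete derivative of the spread 0-form profile is the coarse difference of
the spread 1-form profile). [folklore] -/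
theorem PsigL_add_one_sub [NeZero N₀] (hN : N₀ = side h * Nk) (a : ZMod N₀) (c : ZMod Nk) : PsigL h (a + 1) c - PsigL h a c = PtauL h a (c - 1) - PtauL h a c := by
  rw [PsigL_add_one h hN, PtauL_pred h]
  unfold PsigL PtauL PS
  rw [← sum_sub_distrib, ← sum_sub_distrib]
  refine sum_congr rfl fun r _ => ?_
  split_ifs
  · have hc := sigmaL_succ_sub h (tOff h a + r * side h)
    rw [show tOff h a + 1 + r * (side h : ℤ) = tOff h a + r * side h + 1 by ring,
      show tOff h a + (side h : ℤ) + r * side h = tOff h a + r * side h + side h by ring]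
    exact hc
  · simp

/-! ## §4 Exact segment means on the circle -/

/-- **(iv) ON THE CIRCLE — EXACT SEGMENT MEANS**: `Σ_{a ∈ cell c′} Σ_{m<n} Pτ(a + m, c) = n·[c = c′]`. [folklore] -/
theorem PtauL_seg [NeZero N₀] [NeZero Nk] (hN : N₀ = side h * Nk) (c c' : ZMod Nk) :
    ∑ a ∈ (cellFin h c' : Finset (ZMod N₀)), ∑ m ∈ range (side h), PtauL h (a + (m : ZMod N₀)) c = if c = c' then (side h : ℝ) else 0 := by
  have e : ∀ a ∈ (cellFin h c' : Finset (ZMod N₀)), ∑ m ∈ range (side h), PtauL h (a + (m : ZMod N₀)) c =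
      ∑ m ∈ range (side h), PS h (tauL h) (c'.val : ℤ) (tOff h a + m) c := by
    intro a ha
    rw [mem_cellFin] at ha
    refine sum_congr rfl fun m hm => ?_
    rw [mem_range] at hm
    rw [PtauL_add_nat h hN a c m hm, ha]
  rw [sum_congr rfl e]
  unfold PS
  simp_rw [sum_comm (s := range (side h)) (t := trip)]
  rw [sum_comm]
  have e2 : ∀ r ∈ trip, ∑ a ∈ (cellFin h c' : Finset (ZMod N₀)), ∑ m ∈ range (side h), (if c = (((c'.val : ℤ) - r : ℤ) : ZMod Nk) then tauL h (tOff h a + m + r * side h) else 0)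
      = if c = (((c'.val : ℤ) - r : ℤ) : ZMod Nk) then (if (-r) = 0 then (side h : ℝ) else 0) else 0 := by
    intro r _
    split_ifs with hc hr
    · rw [sum_cellFin h hN (fun t => ∑ m ∈ range (side h), tauL h (t + m + r * side h))]
      have := segTL_eq h (-r)
      unfold segTL at this
      rw [if_pos hr] at this
      have e3 : ∑ t ∈ Icc (-(h : ℤ)) h, ∑ m ∈ range (side h), tauL h (t + m + r * side h)
          = ∑ t ∈ Icc (-(h : ℤ)) h, ∑ m ∈ range (side h), tauL h (t + m - (-r) * side h) :=
        sum_congr rfl fun t _ => sum_congr rfl fun m _ => by ring_nf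
      rw [e3]
      have hn0 := (side_real_pos h).ne'
      field_simp at this
      linarith
    · rw [sum_cellFin h hN (fun t => ∑ m ∈ range (side h), tauL h (t + m + r * side h))]
      have := segTL_eq h (-r)
      unfold segTL at this
      rw [if_neg hr] at this
      have e3 : ∑ t ∈ Icc (-(h : ℤ)) h, ∑ m ∈ range (side h), tauL h (t + m + r * side h)
          = ∑ t ∈ Icc (-(h : ℤ)) h, ∑ m ∈ range (side h), tauL h (t + m - (-r) * side h) :=
        sum_congr rfl fun t _ => sum_congr rfl fun m _ => by ring_nf
      rw [e3]
      have hn0 := (side_real_pos h).ne'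
      rcases mul_eq_zero.mp this with h0 | h0
      · exact absurd (inv_eq_zero.mp h0) hn0
      · exact h0
    · simp
  rw [sum_congr rfl e2, sum_trip]
  have hc' : (((c'.val : ℤ) - 0 : ℤ) : ZMod Nk) = c' := by simp
  simp only [hc', neg_zero]
  by_cases hcc : c = c'
  · simp [hcc]
  · simp [hcc]

/-! ## §5 One more shift lemma, the `ℓ¹`-in-the-cell bounds and the Lipschitz rows -/

/-- **THE 1-FORM PROFILE ONE STEP ON**: `PτL(a + 1, c) = PS τ_L q(a) (t(a) + 1) c` (also in the cell-crossing case: the two boundary values vanish since `supp τ_L ⊂ (0, n)`).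
[folklore] -/
theorem PtauL_add_one [NeZero N₀] (hN : N₀ = side h * Nk) (a : ZMod N₀) (c : ZMod Nk) : PtauL h (a + 1) c = PS h (tauL h) (qIdx h a) (tOff h a + 1) c := by
  have hn : (side h : ℤ) = 2 * h + 1 := side_int h
  have ht := tOff_mem h a
  have hp := two_prad_le h
  unfold PtauL
  by_cases hle : tOff h a + 1 ≤ h
  · obtain ⟨h1, h2⟩ := qIdx_tOff_add_of_le h hN a 1 (by push_cast; exact hle)
    push_cast at h1 h2
    rw [h1, h2]
  · have hlt : (h : ℤ) < tOff h a + (1 : ℕ) := by push_cast; omega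
    obtain ⟨h1, h2⟩ := qIdx_tOff_add_of_lt h hN a 1 (by have := side_pos h; omega) hlt
    push_cast at h1 h2
    have h1' : (((qIdx h (a + 1) : ℕ) : ℤ) : ZMod Nk) = ((((qIdx h a : ℕ) : ℤ) + 1 : ℤ) : ZMod Nk) := by push_cast at h1 ⊢; exact h1
    rw [h2, PS_congr_mod h (tauL h) h1', PS_succ_sub_side]
    · exact tauL_eq_zero h (Or.inr (by omega))
    · exact tauL_eq_zero h (Or.inl (by omega))

/-- `Σ_c |PσL(a, c)| ≤ 54`. [folklore] -/
theorem sum_abs_PsigL_le [NeZero Nk] (a : ZMod N₀) : ∑ c : ZMod Nk, |PsigL h a c| ≤ 54 := by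
  have := sum_abs_PS_le (Nk := Nk) h (sigmaL h) (abs_sigmaL_le h) (qIdx h a : ℤ) (tOff h a)
  unfold PsigL; linarith

/-- `Σ_c |PτL(a, c)| ≤ 54/n`. [folklore] -/
theorem sum_abs_PtauL_le [NeZero Nk] (a : ZMod N₀) : ∑ c : ZMod Nk, |PtauL h a c| ≤ 54 / side h := by
  have := sum_abs_PS_le (Nk := Nk) h (tauL h) (abs_tauL_le h) (qIdx h a : ℤ) (tOff h a)
  unfold PtauL
  calc _ ≤ 3 * (18 / (side h : ℝ)) := this
    _ = 54 / side h := by ring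

/-- **★ THE LIPSCHITZ ROW OF THE PERIODISED 0-FORM PROFILE**: `Σ_c |PσL(a+1, c) − PσL(a, c)| ≤ 108/n`. [folklore] -/
theorem sum_abs_PsigL_add_one_sub_le [NeZero N₀] [NeZero Nk] (hN : N₀ = side h * Nk) (a : ZMod N₀) :
    ∑ c : ZMod Nk, |PsigL h (a + 1) c - PsigL h a c| ≤ 108 / side h := by
  have e : ∀ c : ZMod Nk, PsigL h (a + 1) c - PsigL h a c = PS h (fun s => sigmaL h (s + 1) - sigmaL h s) (qIdx h a) (tOff h a) c := by
    intro c
    rw [PsigL_add_one h hN, PS_sub, PS_shift]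
    rfl
  simp_rw [e]
  calc _ ≤ 3 * (36 / (side h : ℝ)) := sum_abs_PS_le (Nk := Nk) h _ (abs_sigmaL_succ_sub_le h) _ _
    _ = 108 / side h := by ring

/-- **★★ THE LIPSCHITZ ROW OF THE PERIODISED 1-FORM PROFILE**: `Σ_c |PτL(a+1, c) − PτL(a, c)| ≤ 330/n²` — the row the step profile lacks (there it is `~ 3α/n`).
[folklore] -/
theorem sum_abs_PtauL_add_one_sub_le [NeZero N₀] [NeZero Nk] (hN : N₀ = side h * Nk) (a : ZMod N₀) :
    ∑ c : ZMod Nk, |PtauL h (a + 1) c - PtauL h a c| ≤ 330 / (side h : ℝ) ^ 2 := by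
  have e : ∀ c : ZMod Nk, PtauL h (a + 1) c - PtauL h a c = PS h (fun s => tauL h (s + 1) - tauL h s) (qIdx h a) (tOff h a) c := by
    intro c
    rw [PtauL_add_one h hN, PS_sub, PS_shift]
    rfl
  simp_rw [e]
  calc _ ≤ 3 * (110 / (side h : ℝ) ^ 2) := sum_abs_PS_le (Nk := Nk) h _ (abs_tauL_succ_sub_le h) _ _
    _ = 330 / (side h : ℝ) ^ 2 := by ring

end Summit.QuantumFields.YangMills.Theorems.LinearLiftProfileLip

end
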